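import Literature.Topology.PlanarFoliations.LimitSets
import Literature.Topology.PlanarFoliations.StabilityBand
import HarnessLib

/-!
# Limit cycles of planar foliations: the limit set is the closed leaf, its holonomy is non-trivial

Topic: Topology / PlanarFoliations, sequel to `LimitSets.lean`, `StabilityBand.lean`. Let `L` be
an open leaf of a bi-oriented foliation of a plane domain `X ↪ ℂ`, with points in a compact set,
and `K = L_y` a **compact** leaf containing an ω-limit point `ι y` of `L` (a *limit cycle*).

* `omegaSet_eq_image_leaf` (+ α) (**proved**): **`ω(L) = ι(K)`** — `ω(L)` is connected
  (`isPreconnected_omegaSet`) and contains `ι(K)`; a point of `ω(L)` off `K` close to `K` would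
  lie in a flow box at `K` on a plaque of height different from that of `K`, giving two points
  of `ω(L)` on one vertical (`omegaSet_vert_subsingleton`).
* `holonomyGerm_ne_id` (+ α) (**proved**): **the holonomy germ of the injective loop of `K` is
  not the identity**: otherwise the fence over it closes up and all leaves through the nearby
  points of the vertical are compact (`ClosedFence.exists_forall_isCompact_leaf`), whereas `L`,
  which is open, crosses that vertical arbitrarily close to `K`.
* `not_homotopic_refl_map` (+ α) (**proved**): hence, for a foliated map `f` into `(M, T)`,
  **the image loop `f ∘ γ` of the injective loop of `K` is not null-homotopic in its leaf of
  `T`** (naturality of holonomy, `IsFoliatedMap.holonomyGerm_eq_id_of_map_homotopic_refl`):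
  Camacho–Lins Neto, Ch. VI §5 / VII §2 — the boundary of the region `R` "is a curve with
  nontrivial holonomy", hence "`g(γ₀)` is not homotopic to a constant in `A_{g(γ₀)}`".

All statements are [folklore].
-/

noncomputable section

open Set Filter Function Bornology Metric
open _root_.Topology unitInterval
open Literature.Topology.FourManifolds Literature.Topology.FourManifolds.Foliation
  Literature.Topology.FourManifolds.OneManifold Literature.Topology.PlaneTopology

namespace Literature.Topology.PlanarFoliations

variable {X : Type*} [TopologicalSpace X] [T2Space X] [SecondCountableTopology X] {F : Foliation ℝ X} {x : X}
variable [NoncompactSpace (F.Leaf x)] {hbi : IsBiOriented F} {ι : X → ℂ} {e : OpenPartialHomeomorph X (ℝ × ℝ)}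

/-! ## The ω-limit set of a leaf spiralling to a closed leaf is the closed leaf -/

/-- Near a point of a compact leaf `K ⊆ ω(L)`, every point of `ω(L)` lies on `K`: in a flow box
at the point, a point of `ω(L)` gives a point of `ω(L)` on the vertical at its height
(`mem_omegaSet_of_mem_plaque`), which must be the height of `K` (`omegaSet_vert_subsingleton`).
[folklore] -/
theorem eventually_mem_image_of_mem_omegaSet (hι : IsOpenEmbedding ι) (he : e ∈ F.atlas) {y k : X}
    (hy : ι y ∈ omegaSet hbi ι x) (hk : k ∈ F.leaf y) (hke : k ∈ e.source) :
    ∀ᶠ z in 𝓝 (ι k), z ∈ omegaSet hbi ι x → z ∈ ι '' F.leaf y := by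
  have hkω : ι k ∈ omegaSet hbi ι x := mem_omegaSet_of_mem_leaf hι hy hk
  set u₀ := (e k).1
  set s := (e k).2
  have hkeq : e.symm (u₀, s) = k := by rw [show (u₀, s) = e k from rfl, e.left_inv hke]
  -- points near `ι k` are `ι (e.symm q)` with `q` near `(u₀, s)`
  have hΦ := isOpenEmbedding_symm he hι
  have hnhds : (fun q : ℝ × ℝ ↦ ι (e.symm q)) '' univ ∈ 𝓝 (ι k) := by
    rw [image_univ, ← hkeq]
    exact hΦ.isOpen_range.mem_nhds (mem_range_self _)
  filter_upwards [hnhds] with z hz hzω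
  obtain ⟨⟨u, t⟩, -, rfl⟩ := hz
  -- the vertical point at height `t` is in `ω(L)`
  have hsrc : e.symm (u, t) ∈ e.source := e.map_target (F.mk_mem_target he u t)
  have hvert : ι (e.symm (u₀, t)) ∈ omegaSet hbi ι x := by
    refine mem_omegaSet_of_mem_plaque he hι hzω hsrc ?_
    rw [e.right_inv (F.mk_mem_target he u t)]
    exact F.symm_mem_plaque he u₀ t
  have hts : t = s := omegaSet_vert_subsingleton (hbi := hbi) he hι hvert (by rw [hkeq]; exact hkω)
  -- so `e.symm (u, t)` is on the plaque of `k`, in `K`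
  refine mem_image_of_mem ι ?_
  rw [← leaf_eq_of_mem hk]
  exact F.plaque_subset_leaf_of_mem he (F.mem_leaf_self k) (by rw [← hkeq]; exact F.symm_mem_plaque he u₀ s)
    (by rw [hts]; exact F.symm_mem_plaque he u s)

/-- **The ω-limit set of an open leaf containing a point of a compact leaf `K` is `ι(K)`**
(Poincaré–Bendixson: the ω-limit set of an orbit accumulating on a closed orbit is that closed
orbit). [folklore] -/
theorem omegaSet_eq_image_leaf (hι : IsOpenEmbedding ι) {C : Set ℂ} (hC : IsCompact C)
    (hmem : ∀ q : F.Leaf x, ι (Leaf.pt q) ∈ C) {y : X} (hy : ι y ∈ omegaSet hbi ι x) (hK : IsCompact (F.leaf y)) :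
    omegaSet hbi ι x = ι '' F.leaf y := by
  have hsub : ι '' F.leaf y ⊆ omegaSet hbi ι x := by
    rintro _ ⟨k, hk, rfl⟩; exact mem_omegaSet_of_mem_leaf hι hy hk
  refine Subset.antisymm ?_ hsub
  -- `ι K` is closed and (relatively) open in the connected `ω(L)`
  have hconn := isPreconnected_omegaSet (hbi := hbi) hι hC hmem
  have hKc : IsClosed (ι '' F.leaf y) := (hK.image hι.continuous).isClosed
  -- an open set `U ⊇ ι K` with `U ∩ ω ⊆ ι K`
  have hU : ∀ k ∈ F.leaf y, ∃ U ∈ 𝓝 (ι k), ∀ z ∈ U, z ∈ omegaSet hbi ι x → z ∈ ι '' F.leaf y := fun k hk ↦ by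
    obtain ⟨e, he, hke⟩ := F.exists_mem_source k
    exact Filter.eventually_iff_exists_mem.1 (eventually_mem_image_of_mem_omegaSet hι he hy hk hke)
  choose! U hUn hUω using hU
  set W : Set ℂ := ⋃ k ∈ F.leaf y, interior (U k) with hW
  have hWo : IsOpen W := isOpen_biUnion fun _ _ ↦ isOpen_interior
  have hKW : ι '' F.leaf y ⊆ W := by
    rintro _ ⟨k, hk, rfl⟩
    exact mem_biUnion hk (mem_interior_iff_mem_nhds.2 (hUn k hk))
  have hWω : ∀ z ∈ W, z ∈ omegaSet hbi ι x → z ∈ ι '' F.leaf y := fun z hz hzω ↦ by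
    rw [hW, mem_iUnion₂] at hz
    obtain ⟨k, hk, hz⟩ := hz
    exact hUω k hk z (interior_subset hz) hzω
  -- preconnectedness: `ω ⊆ W ∪ (ι K)ᶜ`, both open, `ω` meets `W`; it cannot meet `(ι K)ᶜ ∩ ...`
  rw [isPreconnected_iff_subset_of_disjoint_closed] at hconn
  have h := hconn (ι '' F.leaf y) Wᶜ hKc hWo.isClosed_compl (fun z hz ↦ by
    by_cases hzW : z ∈ W
    · exact Or.inl (hWω z hzW hz)
    · exact Or.inr hzW) (by
    apply eq_empty_of_forall_notMem
    rintro z ⟨-, hzK, hzW⟩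
    exact hzW (hKW hzK))
  rcases h with h | h
  · exact h
  · exfalso
    have hyK : ι y ∈ ι '' F.leaf y := mem_image_of_mem ι (F.mem_leaf_self y)
    exact h hy (hKW hyK)

/-- **The α-limit set of an open leaf containing a point of a compact leaf `K` is `ι(K)`.**
[folklore] -/
theorem alphaSet_eq_image_leaf (hι : IsOpenEmbedding ι) {C : Set ℂ} (hC : IsCompact C)
    (hmem : ∀ q : F.Leaf x, ι (Leaf.pt q) ∈ C) {y : X} (hy : ι y ∈ alphaSet hbi ι x) (hK : IsCompact (F.leaf y)) :
    alphaSet hbi ι x = ι '' F.leaf y := by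
  rw [alphaSet_eq_omegaSet_flip] at hy ⊢
  have h := omegaSet_eq_image_leaf (hbi := isBiOriented_flip hbi) hι hC (fun q ↦ hmem ((Leaf.toFlip x).symm q)) hy
    (by rw [leaf_flip]; exact hK)
  rw [leaf_flip] at h
  exact h

/-! ## The holonomy of a limit cycle is non-trivial -/

variable {y : X} {γ : ℝ → F.Leaf y} {e₀ : OpenPartialHomeomorph X (ℝ × ℝ)}

/-- **The holonomy germ of the injective loop of a limit cycle is not the identity.** Let `K` be
a compact leaf with injective leaf loop `γ` based in the flow box `e₀`, and `L` an open leaf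
with an ω-limit point on `K`. If the holonomy germ of `γ` were the identity, the fence over `γ`
would close up and the leaves through the points of the vertical near the base point would be
compact (`ClosedFence.exists_forall_isCompact_leaf`); but `L` crosses that vertical at heights
arbitrarily close to the base height (`exists_crossing_near₀`). [folklore] -/
theorem holonomyGerm_ne_id_of_mem_omegaSet (hbi : IsBiOriented F) (hι : IsOpenEmbedding ι)
    (ho : F.IsTransverselyOriented) (hc : Continuous γ) (hp : Periodic γ 1) (hinj : InjOn γ (Ico 0 1))
    (he₀ : e₀ ∈ F.atlas) (hx₀ : loopBase γ ∈ e₀.source) (hy : ι y ∈ omegaSet hbi ι x) :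
    F.holonomyGerm he₀ hx₀ (Path.Homotopic.Quotient.mk
      (F.leafLoop (loopPath γ hc hp) (continuous_toLeafSpace_loopPath γ hc hp))) he₀ hx₀ ≠ ↑(id : ℝ → ℝ) := by
  intro hid
  obtain ⟨C⟩ := exists_closedFence ho hc hp hinj he₀ hx₀ hid
  obtain ⟨δ, hδ, -, hcompact⟩ := ClosedFence.exists_forall_isCompact_leaf hbi C
  -- the base point, on `K`, is an ω-limit point; a crossing of `L` nearby
  have hbase : ι (loopBase γ) ∈ omegaSet hbi ι x := mem_omegaSet_of_mem_leaf hι hy (loopBase_mem_leaf γ)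
  have hbase' : ι (e₀.symm (baseCoord γ e₀, baseLevel γ e₀)) ∈ omegaSet hbi ι x := by
    rw [← vert_def, vert_baseLevel hx₀]; exact hbase
  obtain ⟨cr, hcr, hnear⟩ := exists_crossing_near₀ (hbi := hbi) he₀ hι hbase' hδ
  -- its leaf `L` would be compact
  have hmem : ht e₀ cr ∈ Ioo (baseLevel γ e₀ - δ) (baseLevel γ e₀ + δ) := by
    rw [abs_lt] at hnear; constructor <;> linarith [hnear.1, hnear.2]
  have hK := hcompact _ hmem
  rw [vert_def, ← hcr.pt_eq, leaf_eq_of_mem (show Leaf.pt cr ∈ F.leaf x from cr.2)] at hK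
  exact (not_compactSpace_iff.2 ‹NoncompactSpace (F.Leaf x)›) (compactSpace_leaf_of_isCompact hK)

/-- **The holonomy germ of the injective loop of an α-limit cycle is not the identity.**
[folklore] -/
theorem holonomyGerm_ne_id_of_mem_alphaSet (hbi : IsBiOriented F) (hι : IsOpenEmbedding ι)
    (ho : F.IsTransverselyOriented) (hc : Continuous γ) (hp : Periodic γ 1) (hinj : InjOn γ (Ico 0 1))
    (he₀ : e₀ ∈ F.atlas) (hx₀ : loopBase γ ∈ e₀.source) (hy : ι y ∈ alphaSet hbi ι x) :
    F.holonomyGerm he₀ hx₀ (Path.Homotopic.Quotient.mk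
      (F.leafLoop (loopPath γ hc hp) (continuous_toLeafSpace_loopPath γ hc hp))) he₀ hx₀ ≠ ↑(id : ℝ → ℝ) := by
  intro hid
  obtain ⟨C⟩ := exists_closedFence ho hc hp hinj he₀ hx₀ hid
  obtain ⟨δ, hδ, -, hcompact⟩ := ClosedFence.exists_forall_isCompact_leaf hbi C
  have hbase : ι (loopBase γ) ∈ alphaSet hbi ι x := mem_alphaSet_of_mem_leaf hι hy (loopBase_mem_leaf γ)
  have hbase' : ι (e₀.symm (baseCoord γ e₀, baseLevel γ e₀)) ∈ alphaSet hbi ι x := by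
    rw [← vert_def, vert_baseLevel hx₀]; exact hbase
  obtain ⟨cr, hcr, hnear⟩ := exists_crossing_near₀_alpha (hbi := hbi) he₀ hι hbase' hδ
  have hmem : ht e₀ cr ∈ Ioo (baseLevel γ e₀ - δ) (baseLevel γ e₀ + δ) := by
    rw [abs_lt] at hnear; constructor <;> linarith [hnear.1, hnear.2]
  have hK := hcompact _ hmem
  rw [vert_def, ← hcr.pt_eq, leaf_eq_of_mem (show Leaf.pt cr ∈ F.leaf x from cr.2)] at hK
  exact (not_compactSpace_iff.2 ‹NoncompactSpace (F.Leaf x)›) (compactSpace_leaf_of_isCompact hK)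

/-! ## The image of a limit cycle under a foliated map is essential -/

variable {B : Type*} [NormedAddCommGroup B] [LocallyConnectedSpace B] {M : Type*} [TopologicalSpace M]
  {T : Foliation B M} {f : X → M}

/-- **The image loop of a limit cycle is not null-homotopic in its leaf.** For a foliated map
`f : (X, F) → (M, T)` and a compact leaf `K` carrying an ω-limit point of an open leaf, the image
`f ∘ γ` of the injective leaf loop of `K` is not null-homotopic in the leaf topology of `T`:
otherwise the holonomy of `γ` would be trivial (naturality,
`IsFoliatedMap.holonomyGerm_eq_id_of_map_homotopic_refl`). [folklore] -/
theorem not_homotopic_refl_map_of_mem_omegaSet (hbi : IsBiOriented F) (hι : IsOpenEmbedding ι)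
    (ho : F.IsTransverselyOriented) (hf : IsFoliatedMap F T f) (hc : Continuous γ) (hp : Periodic γ 1)
    (hinj : InjOn γ (Ico 0 1)) (hy : ι y ∈ omegaSet hbi ι x) :
    ¬ ((F.leafLoop (loopPath γ hc hp) (continuous_toLeafSpace_loopPath γ hc hp)).map hf.continuous_leafMap).Homotopic
      (Path.refl _) := by
  intro hnull
  obtain ⟨e₀, he₀, hx₀⟩ := F.exists_mem_source (loopBase γ)
  obtain ⟨d₀, hd₀, hfx₀⟩ := T.exists_mem_source (f (loopBase γ))
  obtain ⟨φ, hφ, hcomp⟩ := hf.exists_compat he₀ hx₀ hd₀ hfx₀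
  exact holonomyGerm_ne_id_of_mem_omegaSet hbi hι ho hc hp hinj he₀ hx₀ hy
    (hf.holonomyGerm_eq_id_of_map_homotopic_refl he₀ hx₀ hd₀ hfx₀ hφ hcomp _ hnull)

/-- **The image loop of an α-limit cycle is not null-homotopic in its leaf.** [folklore] -/
theorem not_homotopic_refl_map_of_mem_alphaSet (hbi : IsBiOriented F) (hι : IsOpenEmbedding ι)
    (ho : F.IsTransverselyOriented) (hf : IsFoliatedMap F T f) (hc : Continuous γ) (hp : Periodic γ 1)
    (hinj : InjOn γ (Ico 0 1)) (hy : ι y ∈ alphaSet hbi ι x) :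
    ¬ ((F.leafLoop (loopPath γ hc hp) (continuous_toLeafSpace_loopPath γ hc hp)).map hf.continuous_leafMap).Homotopic
      (Path.refl _) := by
  intro hnull
  obtain ⟨e₀, he₀, hx₀⟩ := F.exists_mem_source (loopBase γ)
  obtain ⟨d₀, hd₀, hfx₀⟩ := T.exists_mem_source (f (loopBase γ))
  obtain ⟨φ, hφ, hcomp⟩ := hf.exists_compat he₀ hx₀ hd₀ hfx₀
  exact holonomyGerm_ne_id_of_mem_alphaSet hbi hι ho hc hp hinj he₀ hx₀ hy
    (hf.holonomyGerm_eq_id_of_map_homotopic_refl he₀ hx₀ hd₀ hfx₀ hφ hcomp _ hnull)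

end Literature.Topology.PlanarFoliations
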